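import Literature.NumberTheory.DiophantineGeometry.AbcTwoAdicValuationProofs
import Literature.NumberTheory.DiophantineGeometry.AbcDivisorBoundLinearForms
import Literature.NumberTheory.DiophantineGeometry.AbcValuationProductShimuraProofs
import HarnessLib

/-!
# Pasten's Proposition 15.1 (`d(abc)/(log d(abc))^ν < C_ε^ν ν^{2ν²} rad(abc)^{1+εν}`) from the
# `p`-adic place bounds, and the valuation-product `abc` rung from Theorem 16.4 (ii) + place bounds

A *proofs* file (theorems only: no definition, no named fact) for the named fact
`Literature.NumberTheory.DiophantineGeometry.pastenShimura2024_prop_15_1`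
(`AbcDivisorBoundLinearForms.lean`): H. Pasten, *Shimura curves and the abc conjecture*, J. Number
Theory **254** (2024) 214–335 = arXiv:1705.09251v4, §15.1 Proposition 15.1 (p. 47): "Let `ε > 0`.
There is a constant `C_ε > 1` such that for all triples `a, b, c` of coprime positive integers with
`a + b = c`, we have `d(abc)/(log d(abc))^ν < C_ε^ν ν^{2ν²} rad(abc)^{1+εν}` where `ν = ω(abc)`."

The printed proof uses the Corollary p. 245 of Yu 1994 (`v_p(abc) ≪ (ν_b+ν_c)^{3(ν_b+ν_c)} · p ·
L_b L_c log(L_b L_c) log d(bc)`), which is not in the tree. PROVED here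
(`pastenShimura2024_prop_15_1_of_placeBounds`) from the two `p`-ADIC PLACE BOUNDS of the tree's
Stewart–Yu reconstruction — the binders `hpad` (p ∣ a) / `hpadc` (p ∣ c, `ab > 1`) of
`Literature.Barriers.ABC.BakerMethodBounds_of_placeBounds` for some `K ≥ 1`: for every prime
`p ∣ abc` and every member `x ∈ {a,b,c}` with `p ∣ x`, `v_p(x) log p < Θ · (p/log p)(log p + Y)`
(the swapped triple for `b`), where `Θ ≤ K^{ν+1} Λ`, `Λ = ∏_{q ∣ abc}(1 + log q)` and
`Y = log max{e, 2 log c}` — following the printed architecture: `v_p(abc) + 1 ≤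
4 K^{ν+1} Λ (1+Y)(log 2)^{-2} · p`, and multiplying over `p ∣ abc`, `d(abc) ≤ (4B)^ν rad(abc)`. The
absorptions `Λ ≤ 3^ν ∏ log q ≪_η 3^ν rad^η` (`exists_prod_log_primeFactors_le_mul_rpow`),
`1 + Y ≪ rad^η` (as in print: "`log log(abc) ≪ log rad(abc)`" — here WITHOUT archimedean input, from
the `p ∣ c` bounds, `exists_log_max_exp_le_mul_rpow_of_placeBound_c`), and
`(3K)^{ν²} ≤ ((3K)^{⌈3K⌉})^ν · ν^{2ν²}` (the printed `ν^{2ν²}` absorbs the tree's `K^{ν²}`, cf. §15.2)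
give the printed display with `η = ε/2`. The place bounds concern linear forms in `p`-adic
logarithms of distinct rational PRIMES only; they are supplied by `PastenApproximationBound K`
(`Pasten.padic_bound_a`, `Pasten.padic_bound_c` at threshold `0`; Pasten, Invent. Math. 236 (2024),
Thm 2.1 — a theorem of the tree relative to Evertse–Győry's Thm 4.2.1 over `ℚ`,
`Dioph.pasten2024_thm_2_1`), whence `pastenShimura2024_prop_15_1_of_approximationBound` and the trust
base Evertse–Győry 4.2.1 alone (`pastenShimura2024_prop_15_1_of_evertseGyory`), and by `p`-adic
estimates of Yu-2007 quality for rational primes (the texts `Y07Odd` / `Y07Two` of the route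
`PadicPrimesKummerThird` of summit ABC, Summits side: `placeBound_a_of_y07At`, `placeBound_c_of_y07At`).
With `AbcValuationProductShimuraProofs` the `abc` rung `pasten2024_thm_2_5` follows from
{Pasten's Theorem 16.4 (ii), Evertse–Győry 4.2.1} (`pasten2024_thm_2_5_of_thm_16_4_of_evertseGyory'`)
and from {Pasten's Theorem 16.4 (ii), the two `p`-adic place bounds}
(`pasten2024_thm_2_5_of_thm_16_4_of_placeBounds`, `…_of_pastenShimura2024_thm_16_4_of_placeBounds`).

## References

* [PastenShimura2024] H. Pasten, J. Number Theory 254 (2024) = arXiv:1705.09251v4 — §15.1,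
  Proposition 15.1 with its proof, p. 47; §15.2 (the `exp(O(ν²))` variant).
* [Pasten2024] H. Pasten, Invent. Math. 236 (2024) 373–385 — Thm 2.1.
* [EvertseGyory2015] J.-H. Evertse, K. Győry, CUP 2015 — Thm 4.2.1 (p. 68).
* [StewartYu2001] C. L. Stewart, K. Yu, Duke Math. J. 108 (2001) 169–181 — §3 (the place bounds).
-/

noncomputable section

open Finset Real

namespace Literature.NumberTheory.DiophantineGeometry

open Literature.NumberTheory.DiophantineGeometry.Dioph (PastenApproximationBound pastenK
  one_le_pastenK pasten2024_thm_2_1 evertseGyory_thm_4_2_1_rat)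
open Literature.NumberTheory.DiophantineGeometry.Pasten (theta theta_nonneg padic_bound_a
  padic_bound_c one_le_log_max_exp)
open Literature.Barriers.ABC (one_le_rad_real theta_zero_eq)
open Literature.NumberTheory.Automorphic (IsAdmissibleFactorization IsFreyHellegouarch)

variable {K : ℝ}

/-! ### The uniform bound for Pasten's `Θ` on the three routes -/

/-- `Θ_{uv} = K^{ω(uv)+1} ∏_{q ∣ uv} log q ≤ K^{ω(uvw)+1} · ∏_{q ∣ uvw}(1 + log q)`: the uniform
majorant `K^{ν+1} Λ` of the three route constants (print: the factors `(ν_b+ν_c)^{3(ν_b+ν_c)}` and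
`L_b L_c ≤ L_{abc}`). [cite: PastenShimura2024, Proposition 15.1 (proof, arXiv:1705.09251v4 p. 47)] -/
private theorem theta_zero_le_pow_mul_prod (hK : 1 ≤ K) {u v w : ℕ} (hu : u ≠ 0) (hv : v ≠ 0)
    (hw : w ≠ 0) (huv : u.Coprime v) :
    theta K u v 0 ≤ K ^ ((u * v * w).primeFactors.card + 1) *
      ∏ q ∈ (u * v * w).primeFactors, (1 + Real.log (q : ℝ)) := by
  rw [theta_zero_eq K hu hv huv]
  have hK0 : 0 ≤ K := zero_le_one.trans hK
  have hsub : (u * v).primeFactors ⊆ (u * v * w).primeFactors :=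
    Nat.primeFactors_mono (dvd_mul_right _ _) (by positivity)
  have h1 : K ^ ((u * v).primeFactors.card + 1) ≤ K ^ ((u * v * w).primeFactors.card + 1) :=
    pow_le_pow_right₀ hK (Nat.succ_le_succ (card_le_card hsub))
  have hlog0 : ∀ q ∈ (u * v).primeFactors, 0 ≤ Real.log (q : ℝ) := fun q hq =>
    Real.log_nonneg (by exact_mod_cast (Nat.prime_of_mem_primeFactors hq).one_le)
  have h2 : ∏ q ∈ (u * v).primeFactors, Real.log (q : ℝ) ≤
      ∏ q ∈ (u * v * w).primeFactors, (1 + Real.log (q : ℝ)) :=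
    calc ∏ q ∈ (u * v).primeFactors, Real.log (q : ℝ)
        ≤ ∏ q ∈ (u * v).primeFactors, (1 + Real.log (q : ℝ)) :=
          prod_le_prod hlog0 fun q _ => by linarith
      _ ≤ ∏ q ∈ (u * v * w).primeFactors, (1 + Real.log (q : ℝ)) :=
          prod_le_prod_of_subset_of_one_le hsub (fun q hq => by linarith [hlog0 q hq])
            fun q hq _ => by
              have : 0 ≤ Real.log (q : ℝ) :=
                Real.log_nonneg (by exact_mod_cast (Nat.prime_of_mem_primeFactors hq).one_le)
              linarith
  exact mul_le_mul h1 h2 (prod_nonneg hlog0) (pow_nonneg hK0 _)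

/-- `∏_{q ∣ n}(1 + log q) ≤ 3^{ω(n)} ∏_{q ∣ n} log q` (`1 + log q ≤ 3 log q` for every prime `q`,
as `2 log 2 > 1`). [cite: PastenShimura2024, Proposition 15.1 (proof, arXiv:1705.09251v4 p. 47)] -/
private theorem prod_one_add_log_le (n : ℕ) :
    ∏ q ∈ n.primeFactors, (1 + Real.log (q : ℝ)) ≤
      3 ^ n.primeFactors.card * ∏ q ∈ n.primeFactors, Real.log (q : ℝ) := by
  rw [← prod_const, ← prod_mul_distrib]
  refine prod_le_prod (fun q hq => ?_) fun q hq => ?_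
  · have : 0 ≤ Real.log (q : ℝ) :=
      Real.log_nonneg (by exact_mod_cast (Nat.prime_of_mem_primeFactors hq).one_le)
    linarith
  · have hq2 : (2 : ℝ) ≤ q := by exact_mod_cast (Nat.prime_of_mem_primeFactors hq).two_le
    have hl2 : Real.log 2 ≤ Real.log (q : ℝ) := Real.log_le_log (by norm_num) hq2
    have := Real.log_two_gt_d9
    linarith

/-- The printed `ν^{2ν²}` absorbs a factor `A^{ν²}`: `A^{ν·ν} ≤ (A^{⌈A⌉})^ν · ν^{2ν²}` for `A ≥ 1`
(if `ν ≤ ⌈A⌉` the first factor dominates, otherwise `A < ν ≤ ν²`). §15.2 of the source compares the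
two shapes ("`e^{αn}` as opposed to `n^{αn}`"). [cite: PastenShimura2024, §15.2 (arXiv:1705.09251v4 p. 47)] -/
private theorem pow_mul_self_le {A : ℝ} (hA : 1 ≤ A) (ν : ℕ) :
    A ^ (ν * ν) ≤ (A ^ ⌈A⌉₊) ^ ν * (ν : ℝ) ^ (2 * ν ^ 2) := by
  have hA0 : 0 ≤ A := zero_le_one.trans hA
  rcases Nat.eq_zero_or_pos ν with rfl | hν
  · simp
  have hν1 : (1 : ℝ) ≤ ν := by exact_mod_cast hν
  by_cases hle : ν ≤ ⌈A⌉₊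
  · calc A ^ (ν * ν) ≤ A ^ (⌈A⌉₊ * ν) := pow_le_pow_right₀ hA (Nat.mul_le_mul_right ν hle)
      _ = (A ^ ⌈A⌉₊) ^ ν := pow_mul A ⌈A⌉₊ ν
      _ ≤ (A ^ ⌈A⌉₊) ^ ν * (ν : ℝ) ^ (2 * ν ^ 2) :=
          le_mul_of_one_le_right (by positivity) (one_le_pow₀ hν1)
  · have hlt : A < ν := by
      have h1 : A ≤ ⌈A⌉₊ := Nat.le_ceil A
      have h2 : ((⌈A⌉₊ : ℕ) : ℝ) < ν := by exact_mod_cast (not_le.mp hle)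
      linarith
    have hAν : A ≤ (ν : ℝ) ^ 2 := by nlinarith
    calc A ^ (ν * ν) ≤ ((ν : ℝ) ^ 2) ^ (ν * ν) := pow_le_pow_left₀ hA0 hAν _
      _ = (ν : ℝ) ^ (2 * ν ^ 2) := by rw [← pow_mul]; ring_nf
      _ ≤ (A ^ ⌈A⌉₊) ^ ν * (ν : ℝ) ^ (2 * ν ^ 2) :=
          le_mul_of_one_le_left (by positivity) (one_le_pow₀ (one_le_pow₀ hA))

/-- From a place bound `v · log p < Θ · (p/log p)(log p + Y)` at a prime `p ≥ 2` with `Θ ≤ Θ₁`: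
`v < Θ₁ · (1 + Y)/(log 2)² · p`. [cite: PastenShimura2024, Proposition 15.1 (proof, arXiv:1705.09251v4 p. 47)] -/
private theorem lt_of_placeBound {v Θ Θ₁ Y p : ℝ} (hp : 2 ≤ p) (hΘ0 : 0 ≤ Θ) (hΘ : Θ ≤ Θ₁)
    (hY : 0 ≤ Y) (h : v * Real.log p < Θ * ((p / Real.log p) * (Real.log p + Y))) :
    v < Θ₁ * ((1 + Y) / Real.log 2 ^ 2) * p := by
  have hl2 : 0 < Real.log 2 := Real.log_pos (by norm_num)
  have hl2' : Real.log 2 < 1 := by have := Real.log_two_lt_d9; linarith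
  have hlp : Real.log 2 ≤ Real.log p := Real.log_le_log (by norm_num) hp
  have hlp0 : 0 < Real.log p := lt_of_lt_of_le hl2 hlp
  have hp0 : 0 < p := by linarith
  -- `v < Θ · p · (log p + Y)/(log p)²`
  have h1 : v < Θ * p * (Real.log p + Y) / Real.log p ^ 2 := by
    rw [lt_div_iff₀ (by positivity)]
    calc v * Real.log p ^ 2 = (v * Real.log p) * Real.log p := by ring
      _ < (Θ * ((p / Real.log p) * (Real.log p + Y))) * Real.log p :=
          mul_lt_mul_of_pos_right h hlp0
      _ = Θ * p * (Real.log p + Y) := by field_simp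
  -- `(log p + Y)/(log p)² ≤ (1 + Y)/(log 2)²`
  have h2 : (Real.log p + Y) / Real.log p ^ 2 ≤ (1 + Y) / Real.log 2 ^ 2 := by
    rw [div_le_div_iff₀ (by positivity) (by positivity)]
    have h22 : Real.log 2 ^ 2 ≤ Real.log p := by nlinarith
    have h3 : Real.log p * Real.log 2 ^ 2 ≤ Real.log p ^ 2 := by
      rw [sq (Real.log p)]
      exact mul_le_mul_of_nonneg_left h22 hlp0.le
    have h4 : Y * Real.log 2 ^ 2 ≤ Y * Real.log p ^ 2 := by
      apply mul_le_mul_of_nonneg_left _ hY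
      exact pow_le_pow_left₀ hl2.le hlp 2
    nlinarith
  calc v < Θ * p * (Real.log p + Y) / Real.log p ^ 2 := h1
    _ = Θ * p * ((Real.log p + Y) / Real.log p ^ 2) := by ring
    _ ≤ Θ₁ * p * ((1 + Y) / Real.log 2 ^ 2) := by
        apply mul_le_mul (mul_le_mul_of_nonneg_right hΘ hp0.le) h2 (by positivity)
        exact mul_nonneg (hΘ0.trans hΘ) hp0.le
    _ = Θ₁ * ((1 + Y) / Real.log 2 ^ 2) * p := by ring

/-! ### Proposition 15.1 -/

/-- **Pasten, Proposition 15.1, from the `p`-adic place bounds** (the named fact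
`pastenShimura2024_prop_15_1`, PROVED relative to the two binders `hpad` (p ∣ a) / `hpadc` (p ∣ c,
`ab > 1`) of `Literature.Barriers.ABC.BakerMethodBounds_of_placeBounds` for some `K ≥ 1` — lower
bounds for linear forms in `p`-adic logarithms of distinct rational PRIMES; module docstring for the
architecture, which is the printed one with Yu 1994 replaced by these place bounds and [ABC1]
(`log log(abc) ≪ log rad`) replaced by `exists_log_max_exp_le_mul_rpow_of_placeBound_c`).
[cite: PastenShimura2024, Proposition 15.1 with its proof (§15.1, arXiv:1705.09251v4 p. 47)] -/
theorem pastenShimura2024_prop_15_1_of_placeBounds (hK : 1 ≤ K)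
    (hpad : ∀ {a b c : ℕ}, IsABCTriple a b c → ∀ {p : ℕ}, p.Prime → p ∣ a →
      (a.factorization p : ℝ) * Real.log p < theta K b c 0 *
        ((p / Real.log p) * (Real.log p + Real.log (max (Real.exp 1) (2 * Real.log c)))))
    (hpadc : ∀ {a b c : ℕ}, IsABCTriple a b c → 1 < a * b → ∀ {p : ℕ}, p.Prime → p ∣ c →
      (c.factorization p : ℝ) * Real.log p < theta K a b 0 *
        ((p / Real.log p) * (Real.log p + Real.log (max (Real.exp 1) (2 * Real.log c))))) :
    pastenShimura2024_prop_15_1 := by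
  refine pastenShimura2024_prop_15_1_of_card_divisors_lt fun ε hε => ?_
  -- constants chosen before the triple (kept opaque)
  set η : ℝ := ε / 2 with hηdef
  have hη : 0 < η := by positivity
  obtain ⟨CL, hCL1, hCL⟩ := exists_prod_log_primeFactors_le_mul_rpow hη
  obtain ⟨Y₀, hY₀1, hY₀⟩ := exists_log_max_exp_le_mul_rpow_of_placeBound_c hK hpadc hη
  obtain ⟨c₂, hc₂def⟩ : ∃ c₂ : ℝ, c₂ = (1 + Y₀) / Real.log 2 ^ 2 := ⟨_, rfl⟩
  obtain ⟨K₃, hK₃def⟩ : ∃ K₃ : ℝ, K₃ = 3 * K := ⟨_, rfl⟩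
  have hK₃ : 1 ≤ K₃ := by rw [hK₃def]; linarith
  obtain ⟨Q, hQdef⟩ : ∃ Q : ℝ, Q = K₃ ^ ⌈K₃⌉₊ := ⟨_, rfl⟩
  have hQ1 : 1 ≤ Q := by rw [hQdef]; exact one_le_pow₀ hK₃
  obtain ⟨A₀, hA₀def⟩ : ∃ A₀ : ℝ, A₀ = 4 * (K * CL * c₂) := ⟨_, rfl⟩
  obtain ⟨C₁, hC₁def⟩ : ∃ C₁ : ℝ, C₁ = A₀ * Q := ⟨_, rfl⟩
  have hl2 : 0 < Real.log 2 := Real.log_pos (by norm_num)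
  have hl2' : Real.log 2 < 1 := by have := Real.log_two_lt_d9; linarith
  have hK0 : 0 ≤ K := zero_le_one.trans hK
  have hY₀0 : 0 ≤ Y₀ := zero_le_one.trans hY₀1
  have hc₂1 : 1 ≤ c₂ := by
    rw [hc₂def, le_div_iff₀ (by positivity)]; nlinarith
  have hA₀4 : 4 ≤ A₀ := by
    have : 1 ≤ K * CL * c₂ :=
      one_le_mul_of_one_le_of_one_le (one_le_mul_of_one_le_of_one_le hK hCL1) hc₂1
    rw [hA₀def]; linarith
  have hA₀0 : 0 ≤ A₀ := by linarith
  have hC₁4 : 4 ≤ C₁ := by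
    rw [hC₁def]
    calc (4 : ℝ) = 4 * 1 := by ring
      _ ≤ A₀ * Q := mul_le_mul hA₀4 hQ1 zero_le_one hA₀0
  have hC₁0 : 0 ≤ C₁ := by linarith
  refine ⟨C₁ / Real.log 2 + 1, by
    have : 0 < C₁ / Real.log 2 := div_pos (by linarith) hl2
    linarith, fun a b c h => ?_⟩
  obtain ⟨ha, hb, habc, hcop⟩ := id h
  have hc : 0 < c := by omega
  have h0 := h.mul_ne_zero
  set ν : ℕ := (a * b * c).primeFactors.card with hνdef
  set R : ℝ := (rad a b c : ℝ) with hRdef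
  have hR1 : 1 ≤ R := one_le_rad_real a b c
  have hR0 : 0 < R := lt_of_lt_of_le one_pos hR1
  have hRη : 1 ≤ R ^ η := Real.one_le_rpow hR1 hη.le
  have hν : 1 ≤ ν := by
    rw [hνdef, Nat.succ_le_iff, card_pos, Nat.nonempty_primeFactors]
    exact h.two_le_mul
  have hν0 : (0 : ℝ) < ν := by exact_mod_cast hν
  have hd2 : (2 : ℝ) ≤ ((a * b * c).divisors.card : ℝ) := by
    exact_mod_cast two_le_card_divisors h.two_le_mul
  have hlogd : Real.log 2 ≤ Real.log ((a * b * c).divisors.card : ℝ) :=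
    Real.log_le_log (by norm_num) hd2
  -- the final comparison `C₁^ν ν^{2ν²} R^{1+εν} < C^ν ν^{2ν²} R^{1+εν} (log d)^ν`, given `d ≤ …`
  have hfinal : C₁ ^ ν * ((ν : ℝ) ^ (2 * ν ^ 2) * R ^ ((1 : ℝ) + ε * ν)) <
      (C₁ / Real.log 2 + 1) ^ ν * (ν : ℝ) ^ (2 * ν ^ 2) * R ^ ((1 : ℝ) + ε * ν) *
        Real.log ((a * b * c).divisors.card : ℝ) ^ ν := by
    have h1 : C₁ ^ ν = (C₁ / Real.log 2) ^ ν * Real.log 2 ^ ν := by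
      rw [← mul_pow, div_mul_cancel₀ _ hl2.ne']
    have h2 : Real.log 2 ^ ν ≤ Real.log ((a * b * c).divisors.card : ℝ) ^ ν :=
      pow_le_pow_left₀ hl2.le hlogd ν
    have h3 : (C₁ / Real.log 2) ^ ν < (C₁ / Real.log 2 + 1) ^ ν :=
      pow_lt_pow_left₀ (by linarith) (by positivity) (by omega)
    have hpos : 0 < (ν : ℝ) ^ (2 * ν ^ 2) * R ^ ((1 : ℝ) + ε * ν) := by positivity
    have hl : 0 < Real.log ((a * b * c).divisors.card : ℝ) ^ ν := by
      have : 0 < Real.log ((a * b * c).divisors.card : ℝ) := lt_of_lt_of_le hl2 hlogd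
      positivity
    rw [h1]
    calc (C₁ / Real.log 2) ^ ν * Real.log 2 ^ ν * ((ν : ℝ) ^ (2 * ν ^ 2) * R ^ ((1 : ℝ) + ε * ν))
        ≤ (C₁ / Real.log 2) ^ ν * Real.log ((a * b * c).divisors.card : ℝ) ^ ν *
            ((ν : ℝ) ^ (2 * ν ^ 2) * R ^ ((1 : ℝ) + ε * ν)) := by
          gcongr
      _ < (C₁ / Real.log 2 + 1) ^ ν * Real.log ((a * b * c).divisors.card : ℝ) ^ ν *
            ((ν : ℝ) ^ (2 * ν ^ 2) * R ^ ((1 : ℝ) + ε * ν)) :=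
          mul_lt_mul_of_pos_right (mul_lt_mul_of_pos_right h3 hl) hpos
      _ = _ := by ring
  refine lt_of_le_of_lt ?_ hfinal
  -- the degenerate triple `(1, 1, 2)`
  by_cases hab1 : ¬ 1 < a * b
  · have hab : a * b = 1 := by
      have : 1 ≤ a * b := Nat.one_le_iff_ne_zero.mpr (by positivity)
      omega
    obtain ⟨rfl, rfl⟩ := mul_eq_one.mp hab
    have hc2 : c = 2 := by omega
    subst hc2
    have hν1 : ν = 1 := by
      rw [hνdef, show (1 : ℕ) * 1 * 2 = 2 by norm_num, Nat.Prime.primeFactors Nat.prime_two,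
        card_singleton]
    have hd : ((1 : ℕ) * 1 * 2).divisors.card = 2 := by
      rw [show (1 : ℕ) * 1 * 2 = 2 by norm_num, Nat.Prime.divisors Nat.prime_two, card_pair (by norm_num)]
    rw [hν1, hd]
    have hRpow : (1 : ℝ) ≤ R ^ ((1 : ℝ) + ε * ((1 : ℕ) : ℝ)) := Real.one_le_rpow hR1 (by positivity)
    have h4 : (4 : ℝ) * 1 ≤ C₁ * R ^ ((1 : ℝ) + ε * ((1 : ℕ) : ℝ)) :=
      mul_le_mul hC₁4 hRpow zero_le_one hC₁0
    have h5 : C₁ ^ 1 * ((((1 : ℕ) : ℝ)) ^ (2 * 1 ^ 2) * R ^ ((1 : ℝ) + ε * ((1 : ℕ) : ℝ))) =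
        C₁ * R ^ ((1 : ℝ) + ε * ((1 : ℕ) : ℝ)) := by
      rw [pow_one, Nat.cast_one, one_pow, one_mul]
    rw [h5]
    have h6 : ((2 : ℕ) : ℝ) = 2 := by norm_num
    rw [h6]
    linarith
  rw [not_not] at hab1
  -- notation (opaque)
  obtain ⟨Λ, hΛdef⟩ : ∃ Λ : ℝ, Λ = ∏ q ∈ (a * b * c).primeFactors, (1 + Real.log (q : ℝ)) :=
    ⟨_, rfl⟩
  obtain ⟨Y, hYdef⟩ : ∃ Y : ℝ, Y = Real.log (max (Real.exp 1) (2 * Real.log c)) := ⟨_, rfl⟩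
  obtain ⟨B, hBdef⟩ : ∃ B : ℝ, B = K ^ (ν + 1) * Λ * ((1 + Y) / Real.log 2 ^ 2) := ⟨_, rfl⟩
  have hΛ1 : 1 ≤ Λ := by
    rw [hΛdef]
    refine le_trans (le_of_eq (prod_const_one).symm) (prod_le_prod (fun _ _ => zero_le_one) ?_)
    intro q hq
    have : 0 ≤ Real.log (q : ℝ) :=
      Real.log_nonneg (by exact_mod_cast (Nat.prime_of_mem_primeFactors hq).one_le)
    linarith
  have hΛ0 : 0 ≤ Λ := zero_le_one.trans hΛ1
  have hY0 : 0 ≤ Y := by rw [hYdef]; exact zero_le_one.trans (one_le_log_max_exp _)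
  have hcY1 : 1 ≤ (1 + Y) / Real.log 2 ^ 2 := by rw [le_div_iff₀ (by positivity)]; nlinarith
  have hB1 : 1 ≤ B := by
    rw [hBdef]
    exact one_le_mul_of_one_le_of_one_le
      (one_le_mul_of_one_le_of_one_le (one_le_pow₀ hK) hΛ1) hcY1
  have hB0 : 0 ≤ B := zero_le_one.trans hB1
  -- `Θ ≤ K^{ν+1} Λ` on the three routes
  have hbc : b.Coprime c := by rw [← habc]; exact Nat.coprime_add_self_right.mpr hcop.symm
  have hac : a.Coprime c := by rw [← habc]; exact Nat.coprime_self_add_right.mpr hcop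
  have hΘbc : theta K b c 0 ≤ K ^ (ν + 1) * Λ := by
    have := theta_zero_le_pow_mul_prod hK hb.ne' hc.ne' ha.ne' hbc
    rwa [show b * c * a = a * b * c by ring, ← hΛdef] at this
  have hΘac : theta K a c 0 ≤ K ^ (ν + 1) * Λ := by
    have := theta_zero_le_pow_mul_prod hK ha.ne' hc.ne' hb.ne' hac
    rwa [show a * c * b = a * b * c by ring, ← hΛdef] at this
  have hΘab : theta K a b 0 ≤ K ^ (ν + 1) * Λ := by
    have := theta_zero_le_pow_mul_prod hK ha.ne' hb.ne' hc.ne' hcop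
    rwa [← hΛdef] at this
  -- per prime `p ∣ abc`: `v_p(abc) + 1 ≤ 4 B p`
  have hper : ∀ p ∈ (a * b * c).primeFactors,
      (((a * b * c).factorization p + 1 : ℕ) : ℝ) ≤ 4 * B * p := by
    intro p hp
    have hpp : p.Prime := Nat.prime_of_mem_primeFactors hp
    have hp2 : (2 : ℝ) ≤ p := by exact_mod_cast hpp.two_le
    have hBp : 1 ≤ B * p := one_le_mul_of_one_le_of_one_le hB1 (by linarith)
    have hmem : ∀ {x : ℕ} {Θ : ℝ}, 0 ≤ Θ → Θ ≤ K ^ (ν + 1) * Λ →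
        (p ∣ x → (x.factorization p : ℝ) * Real.log p <
          Θ * ((p / Real.log p) * (Real.log p + Y))) →
        (x.factorization p : ℝ) < B * p := by
      intro x Θ hΘ0 hΘ hplace
      by_cases hpx : p ∣ x
      · have := lt_of_placeBound hp2 hΘ0 hΘ hY0 (hplace hpx)
        rwa [hBdef]
      · rw [Nat.factorization_eq_zero_of_not_dvd hpx, Nat.cast_zero]
        linarith
    have hva : (a.factorization p : ℝ) < B * p :=
      hmem (theta_nonneg hK0 b c 0) hΘbc fun hpa => hYdef ▸ hpad h hpp hpa
    have hvb : (b.factorization p : ℝ) < B * p :=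
      hmem (theta_nonneg hK0 a c 0) hΘac fun hpb => hYdef ▸ hpad h.swap hpp hpb
    have hvc : (c.factorization p : ℝ) < B * p :=
      hmem (theta_nonneg hK0 a b 0) hΘab fun hpc => hYdef ▸ hpadc h hab1 hpp hpc
    have hsum : (a * b * c).factorization p =
        a.factorization p + b.factorization p + c.factorization p := by
      rw [Nat.factorization_mul (by positivity) hc.ne', Nat.factorization_mul ha.ne' hb.ne']
      rfl
    rw [hsum]
    push_cast
    linarith
  -- `d(abc) ≤ (4B)^ν · R`
  have hd : ((a * b * c).divisors.card : ℝ) ≤ (4 * B) ^ ν * R := by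
    have h1 : ((a * b * c).divisors.card : ℝ) =
        ∏ p ∈ (a * b * c).primeFactors, (((a * b * c).factorization p + 1 : ℕ) : ℝ) := by
      rw [Nat.card_divisors h0, Nat.cast_prod]
    rw [h1, hRdef, cast_rad_eq_prod, hνdef, ← prod_const, ← prod_mul_distrib]
    exact prod_le_prod (fun p _ => by positivity) hper
  -- absorptions: `4B ≤ A₀ K₃^ν (R^η)²`
  have hΛ : Λ ≤ 3 ^ ν * (CL * R ^ η) := by
    rw [hΛdef]
    calc ∏ q ∈ (a * b * c).primeFactors, (1 + Real.log (q : ℝ))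
        ≤ 3 ^ ν * ∏ q ∈ (a * b * c).primeFactors, Real.log (q : ℝ) := prod_one_add_log_le _
      _ ≤ 3 ^ ν * (CL * R ^ η) := by
          apply mul_le_mul_of_nonneg_left _ (by positivity)
          have := hCL (a * b * c)
          rwa [← cast_rad_eq_prod] at this
  have hYle : Y ≤ Y₀ * R ^ η := by rw [hYdef]; exact hY₀ a b c h
  have h1Y : (1 + Y) / Real.log 2 ^ 2 ≤ c₂ * R ^ η := by
    rw [hc₂def, div_mul_eq_mul_div, div_le_div_iff_of_pos_right (by positivity)]
    calc 1 + Y ≤ R ^ η + Y₀ * R ^ η := add_le_add hRη hYle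
      _ = (1 + Y₀) * R ^ η := by ring
  have h4B : 4 * B ≤ A₀ * K₃ ^ ν * (R ^ η) ^ 2 := by
    have hKν : 0 ≤ K ^ (ν + 1) := pow_nonneg hK0 _
    calc 4 * B = 4 * (K ^ (ν + 1) * Λ * ((1 + Y) / Real.log 2 ^ 2)) := by rw [hBdef]
      _ ≤ 4 * (K ^ (ν + 1) * (3 ^ ν * (CL * R ^ η)) * (c₂ * R ^ η)) := by gcongr
      _ = A₀ * K₃ ^ ν * (R ^ η) ^ 2 := by rw [hA₀def, hK₃def, mul_pow, pow_succ]; ring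
  -- `(4B)^ν R ≤ C₁^ν ν^{2ν²} R^{1+εν}`
  have hRpow : ((R ^ η) ^ 2) ^ ν * R = R ^ ((1 : ℝ) + ε * ν) := by
    rw [← pow_mul, ← Real.rpow_natCast, ← Real.rpow_mul hR0.le, ← Real.rpow_add_one hR0.ne']
    congr 1
    rw [hηdef]; push_cast; ring
  have hK₃pow : K₃ ^ (ν * ν) ≤ Q ^ ν * (ν : ℝ) ^ (2 * ν ^ 2) := by
    rw [hQdef]; exact pow_mul_self_le hK₃ ν
  have hGR : 0 ≤ ((R ^ η) ^ 2) ^ ν * R := by positivity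
  calc ((a * b * c).divisors.card : ℝ) ≤ (4 * B) ^ ν * R := hd
    _ ≤ (A₀ * K₃ ^ ν * (R ^ η) ^ 2) ^ ν * R :=
        mul_le_mul_of_nonneg_right (pow_le_pow_left₀ (by positivity) h4B ν) hR0.le
    _ = A₀ ^ ν * K₃ ^ (ν * ν) * (((R ^ η) ^ 2) ^ ν * R) := by
        rw [mul_pow, mul_pow, ← pow_mul]; ring
    _ ≤ A₀ ^ ν * (Q ^ ν * (ν : ℝ) ^ (2 * ν ^ 2)) * (((R ^ η) ^ 2) ^ ν * R) :=
        mul_le_mul_of_nonneg_right (mul_le_mul_of_nonneg_left hK₃pow (pow_nonneg hA₀0 ν)) hGR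
    _ = C₁ ^ ν * ((ν : ℝ) ^ (2 * ν ^ 2) * R ^ ((1 : ℝ) + ε * ν)) := by
        rw [hRpow, hC₁def, mul_pow]; ring

/-- **Pasten, Proposition 15.1, from the approximation bound** (`PastenApproximationBound K`,
`K ≥ 1`: the two place bounds are the tree's `Pasten.padic_bound_a`, `Pasten.padic_bound_c` at
threshold `N = 0`). [cite: PastenShimura2024, Proposition 15.1 with its proof (§15.1, arXiv:1705.09251v4 p. 47)] -/
theorem pastenShimura2024_prop_15_1_of_approximationBound (hK : 1 ≤ K)
    (hP : PastenApproximationBound K) : pastenShimura2024_prop_15_1 :=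
  pastenShimura2024_prop_15_1_of_placeBounds hK (fun h _ hp hpa => padic_bound_a hK hP h 0 hp hpa)
    fun h h1 _ hp hpc => padic_bound_c hK hP h h1 0 hp hpc

/-- **Proposition 15.1 with the trust base of the tree**: from Evertse–Győry's Theorem 4.2.1 over
`ℚ` (`Dioph.evertseGyory_thm_4_2_1_rat`) through `pasten2024_thm_2_1` (`K = pastenK`).
[cite: PastenShimura2024, Proposition 15.1 (§15.1, arXiv:1705.09251v4 p. 47)]
[cite: EvertseGyory2015, Theorem 4.2.1 (p. 68)] -/
theorem pastenShimura2024_prop_15_1_of_evertseGyory (hEG : evertseGyory_thm_4_2_1_rat) :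
    pastenShimura2024_prop_15_1 :=
  pastenShimura2024_prop_15_1_of_approximationBound one_le_pastenK (pasten2024_thm_2_1 hEG)

/-- **The valuation-product `abc` rung from TWO printed theorems.** Pasten's Theorem 16.7 / JNT
Thm 16.8 (`pasten2024_thm_2_5`: `∏_{p ∣ abc} ν_p(abc) ≤ κ_ε rad(abc)^{8/3+ε}`) follows from the typed
Theorem 16.4 (`pastenShimura2024_thm_16_4`, the Shimura-curve engine; used through its case (ii))
and Evertse–Győry's Theorem 4.2.1 over `ℚ` (`Dioph.evertseGyory_thm_4_2_1_rat`, Matveev + Yu) —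
Proposition 15.1 and Lemma 15.2 being theorems relative to the latter
(`pastenShimura2024_prop_15_1_of_evertseGyory`, `factorization_two_lt_of_evertseGyory`).
[cite: PastenShimura2024, Theorem 16.7 with its proof (§16.4, arXiv:1705.09251v4 p. 51)]
[cite: EvertseGyory2015, Theorem 4.2.1 (p. 68)] -/
theorem pasten2024_thm_2_5_of_thm_16_4_of_evertseGyory' (hEG : evertseGyory_thm_4_2_1_rat)
    (h164 : pastenShimura2024_thm_16_4) : pasten2024_thm_2_5 :=
  pasten2024_thm_2_5_of_pastenShimura2024_thm_16_4 hEG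
    (pastenShimura2024_prop_15_1_of_evertseGyory hEG) h164

/-! ### The rung from Theorem 16.4 (ii) and the `p`-adic place bounds alone -/

/-- **The valuation-product `abc` rung from Theorem 16.4 (ii) and `p`-adic linear forms in
logarithms of rational PRIMES.** If for some `K ≥ 1` every abc triple satisfies the two `p`-adic
place bounds of the tree's Stewart–Yu reconstruction — (p ∣ a)
`ν_p(a) log p < Θ_{bc} · (p/log p)(log p + Y)` and, when `ab > 1`, (p ∣ c)
`ν_p(c) log p < Θ_{ab} · (p/log p)(log p + Y)`, `Θ_{uv} = theta K u v 0 = K^{ω(uv)+1} ∏_{q ∣ uv} log q`,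
`Y = log max{e, 2 log c}` (the binders of `Literature.Barriers.ABC.BakerMethodBounds_of_placeBounds`)
— and Theorem 16.4 (ii) of arXiv:1705.09251v4 holds (binder `h164`, case (ii) of the typed fact
`pastenShimura2024_thm_16_4`), then `pasten2024_thm_2_5`: Proposition 15.1
(`pastenShimura2024_prop_15_1_of_placeBounds`) and Lemma 15.2 (`factorization_two_lt_of_placeBounds`)
are theorems relative to the place bounds, with NO archimedean estimate (the `p ∣ c` bounds already
give `log c ≪_K rad^6`, `exists_log_le_mul_pow_six_of_placeBound_c`). The place bounds are supplied
by `PastenApproximationBound K` (`Pasten.padic_bound_a/_c`; hence by Evertse–Győry 4.2.1,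
`pasten2024_thm_2_5_of_thm_16_4_of_evertseGyory'`) and by `p`-adic estimates of Yu-2007 quality for
rational primes (the texts `Y07Odd`, `Y07Two` of the route `PadicPrimesKummerThird` of summit ABC, via
the cell's `Summit.ABC.StewartYu.KummerThird.placeBound_a_of_y07At` / `placeBound_c_of_y07At` with
`K = max 4 C`). [cite: PastenShimura2024, Theorem 16.7 with its proof (§16.4, arXiv:1705.09251v4 p. 51)]
[cite: StewartYu2001, §3] -/
theorem pasten2024_thm_2_5_of_thm_16_4_of_placeBounds (hK : 1 ≤ K)
    (hpad : ∀ {a b c : ℕ}, IsABCTriple a b c → ∀ {p : ℕ}, p.Prime → p ∣ a →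
      (a.factorization p : ℝ) * Real.log p < theta K b c 0 *
        ((p / Real.log p) * (Real.log p + Real.log (max (Real.exp 1) (2 * Real.log c)))))
    (hpadc : ∀ {a b c : ℕ}, IsABCTriple a b c → 1 < a * b → ∀ {p : ℕ}, p.Prime → p ∣ c →
      (c.factorization p : ℝ) * Real.log p < theta K a b 0 *
        ((p / Real.log p) * (Real.log p + Real.log (max (Real.exp 1) (2 * Real.log c)))))
    (h164 : ∀ ε : ℝ, 0 < ε → ∃ N₀ : ℕ, ∀ (W : WeierstrassCurve ℚ) [W.IsElliptic],
      IsFreyHellegouarch W → N₀ ≤ W.conductorNorm ℤ →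
        ∀ D M : ℕ, IsAdmissibleFactorization (W.conductorNorm ℤ) D M →
          2 ≤ (M.primeFactors.erase 2).card →
            ((∏ p ∈ D.primeFactors, (W.minimalDiscriminantNorm ℤ).factorization p : ℕ) : ℝ)
              < (W.conductorNorm ℤ : ℝ) ^ ((8 : ℝ) / 3 + ε) * (M : ℝ)) :
    pasten2024_thm_2_5 :=
  pasten2024_thm_2_5_of_thm_16_4_of_twoAdicBound (factorization_two_lt_of_placeBounds hK hpad hpadc)
    (pastenShimura2024_prop_15_1_of_placeBounds hK hpad hpadc) h164

/-- **The `abc` rung BY NAME from the typed Theorem 16.4 and the `p`-adic place bounds**: the trust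
base of `pasten2024_thm_2_5` along this road is {`pastenShimura2024_thm_16_4`, the two place-bound
binders} — for the route `PadicPrimesKummerThird` of summit ABC: {Thm 16.4, `Y07Odd`, `Y07Two`}.
[cite: PastenShimura2024, Theorem 16.7 with its proof (§16.4, arXiv:1705.09251v4 p. 51)] -/
theorem pasten2024_thm_2_5_of_pastenShimura2024_thm_16_4_of_placeBounds (hK : 1 ≤ K)
    (hpad : ∀ {a b c : ℕ}, IsABCTriple a b c → ∀ {p : ℕ}, p.Prime → p ∣ a →
      (a.factorization p : ℝ) * Real.log p < theta K b c 0 *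
        ((p / Real.log p) * (Real.log p + Real.log (max (Real.exp 1) (2 * Real.log c)))))
    (hpadc : ∀ {a b c : ℕ}, IsABCTriple a b c → 1 < a * b → ∀ {p : ℕ}, p.Prime → p ∣ c →
      (c.factorization p : ℝ) * Real.log p < theta K a b 0 *
        ((p / Real.log p) * (Real.log p + Real.log (max (Real.exp 1) (2 * Real.log c)))))
    (h164 : pastenShimura2024_thm_16_4) : pasten2024_thm_2_5 :=
  pasten2024_thm_2_5_of_thm_16_4_of_placeBounds hK hpad hpadc h164.freyHellegouarch

end Literature.NumberTheory.DiophantineGeometry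

end
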